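import Literature.NumberTheory.Transcendental.RoySmallValueEstimatesReversalProofs
import HarnessLib

/-!
# Route `RoyCriterion`, crux `NguyenRoySmallValueTranslates` (stmt-Schanuel-1051), line `Sketch`
# — stub `stub_edgeOneAlgebraic`, helper file 1: coordinates of close points

Helper lemmas (first file) for the registered stub I (`stub_edgeOneAlgebraic`) of the skeleton of
line `Sketch` for the crux `Summit.Schanuel.Schanuel.Theses.RoyCriterion.NguyenRoySmallValueTranslates`
(Nguyen–Roy 2016, Theorem 1 at the Dirichlet edge `ν > 2 + β − σ`, when one coordinate of
`(ξ, η)` is algebraic). Concrete projective-plane geometry used by the "exactness of one affine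
coordinate" step:

* `norm_gvec_le` — `‖γ̲_k‖ ≤ (1 + |ξ| + |r| + |η|) e^{(1 + log|s|) k}` for `k ≥ 0`, `|s| ≥ 1`;
* `close_rep`, `coord_close` — a vector `v` projectively close to `w` with `w₀ = 1` has `v₀ ≠ 0`,
  `‖v‖ ≤ 2 |v₀| ‖w‖` and, once normalised (`v₀ = 1`), `|v_j − w_j| ≤ 2 dist ‖w‖²`;
* `nv_zero_eq_one`, `ap_zero_eq_one` — pivot bookkeeping for normalised coordinates;
* the two coordinate embeddings `t ↦ (1 : t : 0)` and `t ↦ (0 : 1 : t)` of `ℂ` into `ℙ²(ℂ)`: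
  non-vanishing, `dist ≤ |t − t'|` (`pdist_e1_le`, `pdist_e2_le`), injectivity, and the orbit
  coordinates `ξ + kr`, `η sᵏ` as injective functions of `k`;
* `exists_Xi`, `exists_Eta` — for `ξ ∈ ℚ̄` (resp. `η ∈ ℚ̄`) the points `(1 : ξ + kr : 0)` (resp.
  `(0 : 1 : η sᵏ)`) are the translates `τᵏ` of ONE algebraic point.

## References

* [NguyenRoy2016] N. A. V. Nguyen, D. Roy, IJNT 12 (2016) 1273–1293 = arXiv:1412.5163, §2 (the
  distance, the points `γ_k`), §4 (algebraic points).
-/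

-- `Summit.Schanuel.Schanuel.…` is the mandated layout of this single-problem summit (CONVENTIONS §1).
set_option linter.dupNamespace false

noncomputable section

open Filter Finset MvPolynomial
open scoped Classical

namespace Summit.Schanuel.Schanuel.Theorems.NguyenRoySharp

open Literature.NumberTheory.Transcendental
open Literature.NumberTheory.Transcendental.NguyenRoy
open Literature.NumberTheory.Transcendental.Nesterenko

/-! ### The size of `γ̲_k` -/

/-- **`‖γ̲_k‖ ≤ (1 + |ξ| + |r| + |η|) · e^{(1 + log |s|) k}`** for `k ≥ 0` and `|s| ≥ 1`
(`γ̲_k = (1, ξ + kr, η sᵏ)`, sup norm). [cite: NguyenRoy2016, §2 (the points γ_k)] -/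
theorem norm_gvec_le (ξ η : ℂ) (r : ℚ) {s : ℚ} (hs : 1 ≤ ‖(s : ℂ)‖) (k : ℕ) :
    ‖gvec ξ η (r : ℂ) (s : ℂ) (k : ℤ)‖ ≤
      (1 + ‖ξ‖ + ‖(r : ℂ)‖ + ‖η‖) * Real.exp ((1 + Real.log ‖(s : ℂ)‖) * k) := by
  set A₀ : ℝ := 1 + ‖ξ‖ + ‖(r : ℂ)‖ + ‖η‖ with hA₀
  set μ : ℝ := 1 + Real.log ‖(s : ℂ)‖ with hμ
  have hlog : 0 ≤ Real.log ‖(s : ℂ)‖ := Real.log_nonneg hs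
  have hμ1 : 1 ≤ μ := by rw [hμ]; linarith
  have hk0 : (0 : ℝ) ≤ k := Nat.cast_nonneg _
  have hξ0 : 0 ≤ ‖ξ‖ := norm_nonneg _
  have hr0 : 0 ≤ ‖(r : ℂ)‖ := norm_nonneg _
  have hη0 : 0 ≤ ‖η‖ := norm_nonneg _
  have hA1 : 1 ≤ A₀ := by rw [hA₀]; linarith
  have hexp1 : 1 ≤ Real.exp (μ * k) := Real.one_le_exp (mul_nonneg (by linarith) hk0)
  have hkexp : (k : ℝ) ≤ Real.exp (μ * k) := by
    calc (k : ℝ) ≤ k + 1 := by linarith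
      _ ≤ Real.exp k := Real.add_one_le_exp _
      _ ≤ Real.exp (μ * k) := Real.exp_le_exp.mpr (by nlinarith)
  have hspow : ‖(s : ℂ)‖ ^ k ≤ Real.exp (μ * k) := by
    have hpos : 0 < ‖(s : ℂ)‖ := by linarith
    rw [← Real.exp_log hpos, ← Real.exp_nat_mul]
    exact Real.exp_le_exp.mpr (by rw [hμ]; nlinarith)
  have hgoal : 0 ≤ A₀ * Real.exp (μ * k) := by positivity
  rw [pi_norm_le_iff_of_nonneg hgoal]
  intro i
  fin_cases i
  · simp only [gvec, Fin.zero_eta, Matrix.cons_val_zero, norm_one]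
    nlinarith
  · simp only [gvec, Fin.mk_one, Matrix.cons_val_one, Matrix.cons_val_zero, Int.cast_natCast]
    calc ‖ξ + (k : ℂ) * (r : ℂ)‖ ≤ ‖ξ‖ + ‖(k : ℂ) * (r : ℂ)‖ := norm_add_le _ _
      _ = ‖ξ‖ + k * ‖(r : ℂ)‖ := by rw [norm_mul, Complex.norm_natCast]
      _ ≤ ‖ξ‖ * Real.exp (μ * k) + Real.exp (μ * k) * ‖(r : ℂ)‖ := by
          have h1 : ‖ξ‖ * 1 ≤ ‖ξ‖ * Real.exp (μ * k) := mul_le_mul_of_nonneg_left hexp1 hξ0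
          have h2 : (k : ℝ) * ‖(r : ℂ)‖ ≤ Real.exp (μ * k) * ‖(r : ℂ)‖ :=
            mul_le_mul_of_nonneg_right hkexp hr0
          linarith
      _ ≤ A₀ * Real.exp (μ * k) := by rw [hA₀]; nlinarith
  · simp only [gvec, Fin.reduceFinMk, Matrix.cons_val, Int.cast_natCast, zpow_natCast]
    rw [norm_mul, norm_pow]
    calc ‖η‖ * ‖(s : ℂ)‖ ^ k ≤ ‖η‖ * Real.exp (μ * k) := mul_le_mul_of_nonneg_left hspow hη0
      _ ≤ A₀ * Real.exp (μ * k) := by rw [hA₀]; nlinarith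

/-! ### Vectors projectively close to a vector with first coordinate `1` -/

/-- **A vector close to `w` with `w₀ = 1` has a large first coordinate**: if
`dist(v, w) ‖w‖ ≤ 1/2` then `v₀ ≠ 0` and `‖v‖ ≤ 2 |v₀| ‖w‖` (from the minors `v₀ w_j − v_j w₀`).
[cite: NguyenRoy2016, §2 (the distance)] -/
theorem close_rep {v w : V3} (hv : v ≠ 0) (hw : w ≠ 0) (hw0 : w 0 = 1)
    (h : projDist v w * ‖w‖ ≤ 1 / 2) : v 0 ≠ 0 ∧ ‖v‖ ≤ 2 * ‖v 0‖ * ‖w‖ := by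
  have hj : ∀ j, ‖v j‖ ≤ ‖v 0‖ * ‖w‖ + ‖v‖ / 2 := by
    intro j
    have h1 := norm_minor_le_projDist_mul hv hw 0 j
    rw [hw0, mul_one] at h1
    have h2 : ‖v j‖ ≤ ‖v 0 * w j‖ + ‖v 0 * w j - v j‖ := by
      calc ‖v j‖ = ‖v 0 * w j - (v 0 * w j - v j)‖ := by rw [sub_sub_cancel]
        _ ≤ _ := norm_sub_le _ _
    have h3 : ‖v 0 * w j‖ ≤ ‖v 0‖ * ‖w‖ := by
      rw [norm_mul]
      exact mul_le_mul_of_nonneg_left (norm_le_pi_norm w j) (norm_nonneg _)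
    have h4 : projDist v w * (‖v‖ * ‖w‖) ≤ ‖v‖ / 2 := by
      calc projDist v w * (‖v‖ * ‖w‖) = (projDist v w * ‖w‖) * ‖v‖ := by ring
        _ ≤ (1 / 2) * ‖v‖ := mul_le_mul_of_nonneg_right h (norm_nonneg _)
        _ = ‖v‖ / 2 := by ring
    linarith
  have hvn : ‖v‖ ≤ ‖v 0‖ * ‖w‖ + ‖v‖ / 2 := by
    obtain ⟨i, hi⟩ := PhilipponMain.exists_norm_eq_norm_apply v
    have := hj i
    rwa [← hi] at this
  have hv2 : ‖v‖ ≤ 2 * ‖v 0‖ * ‖w‖ := by linarith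
  refine ⟨fun h0 => ?_, hv2⟩
  rw [h0, norm_zero, mul_zero, zero_mul] at hv2
  exact hv (norm_eq_zero.mp (le_antisymm hv2 (norm_nonneg _)))

/-- **The affine coordinates of a close normalised vector**: if `v₀ = w₀ = 1` and
`dist(v, w) ‖w‖ ≤ 1/2` then `|v_j − w_j| ≤ 2 dist(v, w) ‖w‖²`. [cite: NguyenRoy2016, §2 (the distance)] -/
theorem coord_close {v w : V3} (hv : v ≠ 0) (hw : w ≠ 0) (hw0 : w 0 = 1) (hv0 : v 0 = 1)
    (h : projDist v w * ‖w‖ ≤ 1 / 2) (j : Fin 3) :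
    ‖v j - w j‖ ≤ 2 * projDist v w * ‖w‖ ^ 2 := by
  have hvn := (close_rep hv hw hw0 h).2
  rw [hv0, norm_one, mul_one] at hvn
  have h1 := norm_minor_le_projDist_mul hv hw 0 j
  rw [hw0, hv0, mul_one, one_mul, norm_sub_rev] at h1
  have hd : 0 ≤ projDist v w := projDist_nonneg _ _
  have hw' : 0 ≤ ‖w‖ := norm_nonneg _
  calc ‖v j - w j‖ ≤ projDist v w * (‖v‖ * ‖w‖) := h1
    _ ≤ projDist v w * ((2 * ‖w‖) * ‖w‖) :=
        mul_le_mul_of_nonneg_left (mul_le_mul_of_nonneg_right hvn hw') hd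
    _ = 2 * projDist v w * ‖w‖ ^ 2 := by ring

/-! ### Pivot bookkeeping -/

/-- If the first normalised coordinate of a point is non-zero, it is `1`. [folklore] -/
theorem nv_zero_eq_one {a : PPt} (h : nv a 0 ≠ 0) : nv a 0 = 1 := by
  have h0 : a.rep 0 ≠ 0 := by
    intro h0
    apply h
    simp [nv, nrm, h0]
  have hpiv : pivot a.rep = 0 := by simp [pivot, h0]
  simp only [nv, nrm, hpiv]
  exact div_self h0

/-- If a conjugate `φ(Z)` has first normalised coordinate `1`, then `ap Z 0 = 1`. [folklore] -/
theorem ap_zero_eq_one (Z : AlgPt) {φ : Kp Z.1 →ₐ[ℚ] ℂ} (h : nv (Z.embPt φ) 0 = 1) :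
    ap Z.1 0 = 1 := by
  rw [Z.nv_embPt φ] at h
  exact (map_eq_one_iff φ φ.toRingHom.injective).mp h

/-! ### The two coordinate embeddings of `ℂ` into `ℙ²(ℂ)` -/

/-- `(1, t, 0) ≠ 0`. [folklore] -/
theorem e1_ne_zero (t : ℂ) : (![1, t, 0] : V3) ≠ 0 := fun h => by
  have := congrFun h 0
  simp at this

/-- `(0, 1, t) ≠ 0`. [folklore] -/
theorem e2_ne_zero (t : ℂ) : (![0, 1, t] : V3) ≠ 0 := fun h => by
  have := congrFun h 1
  simp at this

/-- `dist((1:t:0), (1:t':0)) ≤ |t − t'|` (the only non-zero minor is `t' − t`, and both sup norms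
are `≥ 1`). [cite: NguyenRoy2016, §2 (the distance)] -/
theorem pdist_e1_le (t t' : ℂ) :
    pdist (Projectivization.mk ℂ ![1, t, 0] (e1_ne_zero t))
      (Projectivization.mk ℂ ![1, t', 0] (e1_ne_zero t')) ≤ ‖t - t'‖ := by
  rw [pdist_mk]
  have hV1 : 1 ≤ ‖(![1, t, 0] : V3)‖ := by
    have := norm_le_pi_norm (![1, t, 0] : V3) 0
    rwa [Matrix.cons_val_zero, norm_one] at this
  have hW1 : 1 ≤ ‖(![1, t', 0] : V3)‖ := by
    have := norm_le_pi_norm (![1, t', 0] : V3) 0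
    rwa [Matrix.cons_val_zero, norm_one] at this
  have hVW : 1 ≤ ‖(![1, t, 0] : V3)‖ * ‖(![1, t', 0] : V3)‖ :=
    one_le_mul_of_one_le_of_one_le hV1 hW1
  refine projDist_le_of_minor_le (e1_ne_zero t) (e1_ne_zero t') (norm_nonneg _) fun p => ?_
  obtain ⟨⟨i, j⟩, hij⟩ := p
  have hbase : ‖t - t'‖ ≤ ‖t - t'‖ * (‖(![1, t, 0] : V3)‖ * ‖(![1, t', 0] : V3)‖) :=
    le_mul_of_one_le_right (norm_nonneg _) hVW
  fin_cases i <;> fin_cases j <;> simp at hij ⊢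
  rw [norm_sub_rev]
  exact hbase

/-- `dist((0:1:t), (0:1:t')) ≤ |t − t'|`. [cite: NguyenRoy2016, §2 (the distance)] -/
theorem pdist_e2_le (t t' : ℂ) :
    pdist (Projectivization.mk ℂ ![0, 1, t] (e2_ne_zero t))
      (Projectivization.mk ℂ ![0, 1, t'] (e2_ne_zero t')) ≤ ‖t - t'‖ := by
  rw [pdist_mk]
  have hV1 : 1 ≤ ‖(![0, 1, t] : V3)‖ := by
    have := norm_le_pi_norm (![0, 1, t] : V3) 1
    rwa [Matrix.cons_val_one, Matrix.cons_val_zero, norm_one] at this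
  have hW1 : 1 ≤ ‖(![0, 1, t'] : V3)‖ := by
    have := norm_le_pi_norm (![0, 1, t'] : V3) 1
    rwa [Matrix.cons_val_one, Matrix.cons_val_zero, norm_one] at this
  have hVW : 1 ≤ ‖(![0, 1, t] : V3)‖ * ‖(![0, 1, t'] : V3)‖ :=
    one_le_mul_of_one_le_of_one_le hV1 hW1
  refine projDist_le_of_minor_le (e2_ne_zero t) (e2_ne_zero t') (norm_nonneg _) fun p => ?_
  obtain ⟨⟨i, j⟩, hij⟩ := p
  have hbase : ‖t - t'‖ ≤ ‖t - t'‖ * (‖(![0, 1, t] : V3)‖ * ‖(![0, 1, t'] : V3)‖) :=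
    le_mul_of_one_le_right (norm_nonneg _) hVW
  fin_cases i <;> fin_cases j <;> simp at hij ⊢
  rw [norm_sub_rev]
  exact hbase

/-- `(1 : t : 0) = (1 : t' : 0)` forces `t = t'`. [folklore] -/
theorem e1_mk_inj {t t' : ℂ}
    (h : Projectivization.mk ℂ ![1, t, 0] (e1_ne_zero t) = Projectivization.mk ℂ ![1, t', 0] (e1_ne_zero t')) :
    t = t' := by
  rw [Projectivization.mk_eq_mk_iff'] at h
  obtain ⟨c, hc⟩ := h
  have h0 := congrFun hc 0
  have h1 := congrFun hc 1
  simp at h0 h1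
  rw [h0, one_mul] at h1
  exact h1.symm

/-- `(0 : 1 : t) = (0 : 1 : t')` forces `t = t'`. [folklore] -/
theorem e2_mk_inj {t t' : ℂ}
    (h : Projectivization.mk ℂ ![0, 1, t] (e2_ne_zero t) = Projectivization.mk ℂ ![0, 1, t'] (e2_ne_zero t')) :
    t = t' := by
  rw [Projectivization.mk_eq_mk_iff'] at h
  obtain ⟨c, hc⟩ := h
  have h1 := congrFun hc 1
  have h2 := congrFun hc 2
  simp at h1 h2
  rw [h1, one_mul] at h2
  exact h2.symm

/-- The first affine coordinate `ξ + kr` of `γ_k` is injective in `k` (`r ≠ 0`). [cite: NguyenRoy2016, §2] -/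
theorem gvec_one_inj (ξ η : ℂ) {r : ℚ} (hr : r ≠ 0) (s : ℚ) {k k' : ℤ}
    (h : gvec ξ η (r : ℂ) (s : ℂ) k 1 = gvec ξ η (r : ℂ) (s : ℂ) k' 1) : k = k' := by
  simp only [gvec, Matrix.cons_val_one, Matrix.cons_val_zero, add_right_inj] at h
  have hrC : (r : ℂ) ≠ 0 := by exact_mod_cast hr
  exact_mod_cast mul_right_cancel₀ hrC h

/-- The second affine coordinate `η sᵏ` of `γ_k` is injective in `k` (`η ≠ 0`, `s ≠ 0, ±1`).
[cite: NguyenRoy2016, §2] -/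
theorem gvec_two_inj (ξ : ℂ) {η : ℂ} (hη : η ≠ 0) (r : ℚ) {s : ℚ} (hs0 : s ≠ 0) (hs1 : s ≠ 1)
    (hs2 : s ≠ -1) {k k' : ℤ}
    (h : gvec ξ η (r : ℂ) (s : ℂ) k 2 = gvec ξ η (r : ℂ) (s : ℂ) k' 2) : k = k' := by
  simp only [gvec, Matrix.cons_val] at h
  have hsC : (s : ℂ) ≠ 0 := by exact_mod_cast hs0
  have h1 : (s : ℂ) ^ k = (s : ℂ) ^ k' := mul_left_cancel₀ hη h
  by_contra hne
  have hk : k - k' ≠ 0 := sub_ne_zero.mpr hne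
  apply rat_cast_zpow_ne_one hs1 hs2 hk
  rw [zpow_sub₀ hsC, h1, div_self (zpow_ne_zero _ hsC)]

/-! ### The orbit classes of an algebraic coordinate -/

/-- **The classes of `(1 : ξ + kr : 0)` for `ξ ∈ ℚ̄`** are the translates `τᵏ Ξ` of one algebraic
point `Ξ = (1 : ξ : 0)` (presented over `ℚ(ξ)`), since `τ̲ᵏ(1, ξ, 0) = (1, ξ + kr, 0)`.
[cite: NguyenRoy2016, §2 (τ) and §4 (τZ)] -/
theorem exists_Xi {ξ : ℂ} (hξ : IsAlgebraic ℚ ξ) (η : ℂ) (r : ℚ) {s : ℚ} (hs0 : s ≠ 0) :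
    ∃ Ξ : AlgPt, ∀ k : ℤ, (Ξ.tauA r hs0 k).1 =
      Projectivization.mk ℂ ![1, gvec ξ η (r : ℂ) (s : ℂ) k 1, 0] (e1_ne_zero _) := by
  set K : IntermediateField ℚ ℂ := IntermediateField.adjoin ℚ {ξ} with hK
  haveI : FiniteDimensional ℚ K := IntermediateField.adjoin.finiteDimensional hξ.isIntegral
  haveI : NumberField K := NFPres.numberField_of_intermediateField _
  let ξK : K := ⟨ξ, IntermediateField.mem_adjoin_simple_self ℚ ξ⟩
  let b : Fin 3 → K := ![1, ξK, 0]
  have hb : (fun j => algebraMap K ℂ (b j)) = ![1, ξ, 0] := by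
    funext j
    fin_cases j <;> simp [b, ξK]
  have hb0 : (fun j => algebraMap K ℂ (b j)) ≠ 0 := by rw [hb]; exact e1_ne_zero _
  obtain ⟨Ξ, hΞ⟩ : ∃ Ξ : AlgPt, Ξ.1 = Projectivization.mk ℂ _ hb0 :=
    ⟨⟨_, ⟨⟨K, algebraMap K ℂ, b, hb0, rfl⟩⟩⟩, rfl⟩
  refine ⟨Ξ, fun k => ?_⟩
  rw [AlgPt.tauA_val, tauQ, hΞ, tauP_mk]
  apply mk_congr
  rw [hb, tauMat_zpow _ (cast_ne_zero' hs0), tauMatPow_mulVec]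
  funext j
  fin_cases j <;> simp [gvec]
  ring

/-- **The classes of `(0 : 1 : η sᵏ)` for `η ∈ ℚ̄`** are the translates `τᵏ H` of one algebraic
point `H = (0 : 1 : η)` (presented over `ℚ(η)`), since `τ̲ᵏ(0, 1, η) = (0, 1, sᵏ η)`.
[cite: NguyenRoy2016, §2 (τ) and §4 (τZ)] -/
theorem exists_Eta (ξ : ℂ) {η : ℂ} (hη : IsAlgebraic ℚ η) (r : ℚ) {s : ℚ} (hs0 : s ≠ 0) :
    ∃ H : AlgPt, ∀ k : ℤ, (H.tauA r hs0 k).1 =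
      Projectivization.mk ℂ ![0, 1, gvec ξ η (r : ℂ) (s : ℂ) k 2] (e2_ne_zero _) := by
  set K : IntermediateField ℚ ℂ := IntermediateField.adjoin ℚ {η} with hK
  haveI : FiniteDimensional ℚ K := IntermediateField.adjoin.finiteDimensional hη.isIntegral
  haveI : NumberField K := NFPres.numberField_of_intermediateField _
  let ηK : K := ⟨η, IntermediateField.mem_adjoin_simple_self ℚ η⟩
  let b : Fin 3 → K := ![0, 1, ηK]
  have hb : (fun j => algebraMap K ℂ (b j)) = ![0, 1, η] := by
    funext j
    fin_cases j <;> simp [b, ηK]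
  have hb0 : (fun j => algebraMap K ℂ (b j)) ≠ 0 := by rw [hb]; exact e2_ne_zero _
  obtain ⟨H, hH⟩ : ∃ H : AlgPt, H.1 = Projectivization.mk ℂ _ hb0 :=
    ⟨⟨_, ⟨⟨K, algebraMap K ℂ, b, hb0, rfl⟩⟩⟩, rfl⟩
  refine ⟨H, fun k => ?_⟩
  rw [AlgPt.tauA_val, tauQ, hH, tauP_mk]
  apply mk_congr
  rw [hb, tauMat_zpow _ (cast_ne_zero' hs0), tauMatPow_mulVec]
  funext j
  fin_cases j <;> simp [gvec]
  ring

end Summit.Schanuel.Schanuel.Theorems.NguyenRoySharp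

end
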